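import Summits.RiemannHypothesis.RiemannHypothesis.Theorems.PfPersistenceF3SharpLocalTemperedAux

/-!
# F3 — FE-honest twins `ζ·(1 + b p^{-s} + p^{1-2s})` — part 5/5: TEMPERED TRANSFER (kernel) — pub-rhpf fake-3

HONEST FRAMING: mechanism/rigidity campaign; no RH claims.  Split of the single staged module `HOME/lean/PFPersistence/F3SharpLocal.lean` v3 (sha16 1e7c8001eda6007d,
1050 lines, `lean check` rc 0 / 0 sorries) into five ≤ 400-line modules for the gate's line lint (REFEREE r10-b):
`…F3SharpLocalDatum` (datum, SHAPE-TWIN identity, the three statements) → `…F3SharpLocalTwin` (generic twin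
lemmas) → `…F3SharpLocalBound` (THEOREM F3-A) → `…F3SharpLocalTemperedAux` (Newton sums, prime-term difference,
PSD autocorrelation, Fejér) → `…F3SharpLocalTempered` (TEMPERED TRANSFER).  Every `def`/`theorem` statement and
proof is verbatim from v3 (v2 3b05073fba483e09 = ADJ A25 add.3 for F3-A); only headers/imports are per-file.
This part: the coefficient sequence `f(k) = cos(kφ) A_g(k log p)`, `Re Σ Σ f(n-m) ≥ 0`, the POINTWISE domination
`re_weilQuadratic_le_sharpLocal_of_tempered` (`Re Q_ζ(g) ≤ Re Q_F(g)` for every test, new in the split = v4), the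
windowed transfer `sharpLocal_positivityOn_of_tempered`, and the proof of
`sharpLocalTemperedTransfer : SharpLocalTemperedTransfer` (FAKES §3.2(c); ADJ A25 addendum 4, re-run requested).
-/

set_option linter.dupNamespace false

noncomputable section

open MeasureTheory Set Filter Complex
open scoped Real Topology

namespace Summit.RiemannHypothesis.RiemannHypothesis.Theorems.PfPersistenceBarrier

open Literature.NumberTheory.LFunctions ExplicitDatum

namespace F3T

open scoped ComplexConjugate

variable {g : ℝ → ℂ}

/-! #### Assembly -/

/-- The `P`-part coefficient sequence `f(k) = cos(k φ) · A_g(k log p)`. [folklore] -/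
def fcoef (g : ℝ → ℂ) (L φ : ℝ) (k : ℤ) : ℂ :=
  ((Real.cos (k * φ) : ℝ) : ℂ) * weilConv g (weilReflect g) (k * L)

/-- Toeplitz positivity of `fcoef`: `cos((n-m)φ) = ½(e_n ē_m + ē_n e_m)` with `e_n = e^{i n φ}`,
and `A_g` is positive-definite. [folklore] -/
theorem re_sum_sum_fcoef_nonneg (hg : IsWeilTest g) (L φ : ℝ) (N : ℕ) :
    0 ≤ (∑ n ∈ Finset.range N, ∑ m ∈ Finset.range N, fcoef g L φ ((n : ℤ) - m)).re := by
  set e : ℝ → ℕ → ℂ := fun ψ n ↦ Complex.exp ((((n : ℝ) * ψ : ℝ) : ℂ) * I) with he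
  have hconj : ∀ ψ : ℝ, ∀ n : ℕ, conj (e ψ n) = Complex.exp (-((((n : ℝ) * ψ : ℝ) : ℂ) * I)) := by
    intro ψ n
    rw [he]
    simp only [← Complex.exp_conj, map_mul, Complex.conj_ofReal, Complex.conj_I, mul_neg]
  have hterm : ∀ n m : ℕ, fcoef g L φ ((n : ℤ) - m) =
      (1 / 2 : ℂ) * (e φ n * conj (e φ m) * weilConv g (weilReflect g) (n * L - m * L)) +
      (1 / 2 : ℂ) * (e (-φ) n * conj (e (-φ) m) * weilConv g (weilReflect g) (n * L - m * L)) := by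
    intro n m
    have hx : (((n : ℤ) - m : ℤ) : ℝ) * L = n * L - m * L := by push_cast; ring
    have hc : ((Real.cos ((((n : ℤ) - m : ℤ) : ℝ) * φ) : ℝ) : ℂ) =
        (1 / 2 : ℂ) * (e φ n * conj (e φ m)) + (1 / 2 : ℂ) * (e (-φ) n * conj (e (-φ) m)) := by
      rw [hconj, hconj, he]
      simp only [← Complex.exp_add]
      rw [Complex.ofReal_cos, Complex.cos]
      have a1 : ((((n : ℝ) * φ : ℝ) : ℂ) * I) + -((((m : ℝ) * φ : ℝ) : ℂ) * I) =
          (((((n : ℤ) - m : ℤ) : ℝ) * φ : ℝ) : ℂ) * I := by push_cast; ring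
      have a2 : ((((n : ℝ) * -φ : ℝ) : ℂ) * I) + -((((m : ℝ) * -φ : ℝ) : ℂ) * I) =
          -(((((n : ℤ) - m : ℤ) : ℝ) * φ : ℝ) : ℂ) * I := by push_cast; ring
      rw [a1, a2]
      ring
    unfold fcoef
    rw [hx, hc]
    ring
  simp only [hterm, Finset.sum_add_distrib, ← Finset.mul_sum, Complex.add_re]
  have h1 := re_sum_sum_autocorr_nonneg hg (e φ) (fun n ↦ n * L) N
  have h2 := re_sum_sum_autocorr_nonneg hg (e (-φ)) (fun n ↦ n * L) N
  have hre : ∀ z : ℂ, ((1 / 2 : ℂ) * z).re = 1 / 2 * z.re := by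
    intro z; simp [Complex.mul_re]
  rw [hre, hre]
  linarith


end F3T

open F3T in
/-- **TEMPERED DOMINATION, pointwise (kernel; 2026-08-19 split v4):** for `|b| ≤ 2√p` and EVERY
Weil test `g`, `Re Q_ζ(g) ≤ Re Q_{F_{p,b}}(g)`: `Q_F(g) = Q_ζ(g) + 2 log p · P_M(f)` with
`f(k) = cos(kφ) A_g(k log p)` and `Re P_M(f) ≥ 0` by Fejér summation of the positive Toeplitz
double sums of `f` (`re_sum_sum_fcoef_nonneg`).  A tempered FE-honest twin is AT LEAST AS
WEIL-POSITIVE AS `ζ` on every test function — window by window, unconditionally. [folklore] -/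
theorem re_weilQuadratic_le_sharpLocal_of_tempered {p : ℕ} (hp : p.Prime) {b : ℝ}
    (hb : |b| ≤ 2 * Real.sqrt p) {g : ℝ → ℂ} (hg : IsWeilTest g) :
    (weilQuadratic g).re ≤ ((sharpLocalDatum p b).quadratic g).re := by
  have hlp : 0 < Real.log p := Real.log_pos (by exact_mod_cast hp.one_lt)
  -- support of g and of its autocorrelation
  obtain ⟨R, hR⟩ : ∃ R : ℝ, tsupport g ⊆ Icc (-R) R := by
    obtain ⟨r, hr⟩ := hg.2.isCompact.isBounded.subset_closedBall 0
    exact ⟨r, by simpa [Real.closedBall_eq_Icc] using hr⟩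
  have hAs := tsupport_weilConv_weilReflect_subset hg.2 hR
  have hAvan : ∀ u : ℝ, 2 * R < |u| → weilConv g (weilReflect g) u = 0 := by
    intro u hu
    refine eq_zero_of_tsupport_subset hAs ?_
    intro hmem
    have : |u| ≤ 2 * R := abs_le.2 ⟨hmem.1, hmem.2⟩
    linarith
  -- number of visible powers
  obtain ⟨M, hM⟩ : ∃ M : ℕ, 2 * R < (M + 1) * Real.log p := by
    obtain ⟨M, hM⟩ := exists_nat_gt (2 * R / Real.log p)
    refine ⟨M, ?_⟩
    rw [div_lt_iff₀ hlp] at hM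
    nlinarith
  -- the P-part as 2 log p · P_M(f)
  have hprime := primeTerm_sub_eq_sum_pow hp b hAvan hM
  have hS : (∑ m ∈ Finset.range M, ((sharpLocalMass p b (p ^ (m + 1)) : ℝ) : ℂ) *
      (weilConv g (weilReflect g) ((m + 1) * Real.log p) +
        weilConv g (weilReflect g) (-((m + 1) * Real.log p)))) =
      -(2 * (Real.log p : ℂ) * ∑ j ∈ Finset.range M,
        (fcoef g (Real.log p) (phase p b) ((j : ℤ) + 1) +
          fcoef g (Real.log p) (phase p b) (-((j : ℤ) + 1)))) := by
    rw [Finset.mul_sum, ← Finset.sum_neg_distrib]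
    refine Finset.sum_congr rfl fun m _ ↦ ?_
    rw [sharpLocalMass_pow_tempered hp hb]
    unfold fcoef
    simp only [Int.cast_add, Int.cast_neg, Int.cast_one, Int.cast_natCast, Nat.cast_add,
      Nat.cast_one, neg_mul, Real.cos_neg]
    push_cast
    ring
  have h0 : fcoef g (Real.log p) (phase p b) 0 = weilConv g (weilReflect g) 0 := by
    simp [fcoef]
  have hdec : (sharpLocalDatum p b).quadratic g =
      weilQuadratic g + 2 * (Real.log p : ℂ) * Psum (fcoef g (Real.log p) (phase p b)) M := by
    rw [F3A.sharpLocal_quadratic_decomp, hprime, hS]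
    unfold Psum
    rw [h0]
    ring
  -- positivity of the P-part
  have hP : 0 ≤ (Psum (fcoef g (Real.log p) (phase p b)) M).re := by
    refine re_Psum_nonneg _ M (fun N ↦ re_sum_sum_fcoef_nonneg hg _ _ N) fun k hk ↦ ?_
    unfold fcoef
    rw [hAvan _ ?_, mul_zero]
    have hk' : (M : ℝ) + 1 ≤ |(k : ℝ)| := by
      have : (M : ℤ) + 1 ≤ |k| := hk
      exact_mod_cast this
    rw [abs_mul, abs_of_pos hlp]
    nlinarith
  rw [hdec, Complex.add_re]
  have e2 : (2 : ℂ) * (Real.log p : ℂ) = ((2 * Real.log p : ℝ) : ℂ) := by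
    rw [Complex.ofReal_mul, Complex.ofReal_ofNat]
  rw [e2, Complex.re_ofReal_mul]
  have := mul_nonneg (mul_nonneg (by norm_num : (0 : ℝ) ≤ 2) hlp.le) hP
  linarith

/-- **TEMPERED TRANSFER, window by window (kernel):** for `|b| ≤ 2√p`, if `ζ` is Weil-positive on
the window `A` then so is `F_{p,b}` on the same window.  (Observatory reading: a tempered FE-honest
twin certified NEGATIVE at a served `(a, N)` where `ζ` is PSD would contradict this theorem — a
kernel sanity check for positive controls.) [folklore] -/
theorem sharpLocal_positivityOn_of_tempered {p : ℕ} (hp : p.Prime) {b : ℝ}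
    (hb : |b| ≤ 2 * Real.sqrt p) {A : ℝ} (hζ : zetaDatum.PositivityOn A) :
    (sharpLocalDatum p b).PositivityOn A := by
  intro g hg hsupp
  have h := hζ g hg hsupp
  rw [zetaDatum_quadratic] at h
  exact h.trans (re_weilQuadratic_le_sharpLocal_of_tempered hp hb hg)

/-- **TEMPERED TRANSFER, proved (statement verbatim from v2/v3):** for `|b| ≤ 2√p`, if `ζ` is
Weil-positive (on all windows) then so is the FE-honest, non-Euler `F_{p,b}` — immediate from the
pointwise domination `re_weilQuadratic_le_sharpLocal_of_tempered`. [folklore] -/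
theorem sharpLocalTemperedTransfer : SharpLocalTemperedTransfer := by
  intro p hp b hb hζ g hg
  have h := hζ g hg
  rw [zetaDatum_quadratic] at h
  exact h.trans (re_weilQuadratic_le_sharpLocal_of_tempered hp hb hg)

end Summit.RiemannHypothesis.RiemannHypothesis.Theorems.PfPersistenceBarrier
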